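import Mathlib
import HarnessLib

/-!
# HodgeLocusCensusZeta6Pairs — integer-pair arithmetic of ℤ[ζ₆] and its evaluation in a field (cell pub-hlocus, LEAD seat ivhs-1, gen 21)
HONEST FRAMING: certified instances and evidence bearing on the general Hodge conjecture; no claim.

Support file for the point-countersign anchors `HodgeLocusCensusPointChartsA833a/b`, `HodgeLocusCensusPointChartsA832`: elements a + b·ζ₆ of
ℤ[ζ₆] (ζ₆² = ζ₆ − 1) as integer pairs (a, b) with their product `pmul` and powers `ppow`, the evaluation `ev z (a, b) = a + b·z` in a field K,
its multiplicativity under z² = z − 1, and the transport lemma `ev_ident`: an identity den·th = g·dm·dO^S checked ONCE in exact integer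
arithmetic (by `decide +kernel` in the cell files) holds in every field containing a primitive sixth root of unity z.  Pure arithmetic; nothing
here refers to Hodge loci.
-/

namespace Summit.HodgeConjecture.HodgeConjecture.HodgeLocus.Census.Zeta6Pairs

variable {K : Type*} [Field K]

/-- multiplication of ℤ[ζ₆] on integer pairs: (a, b) ↔ a + b·ζ₆ with ζ₆² = ζ₆ − 1. -/
def pmul (x y : ℤ × ℤ) : ℤ × ℤ := (x.1 * y.1 - x.2 * y.2, x.1 * y.2 + x.2 * y.1 + x.2 * y.2)

/-- powers in ℤ[ζ₆] by iterated `pmul`. -/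
def ppow (x : ℤ × ℤ) : ℕ → ℤ × ℤ
  | 0 => (1, 0)
  | n + 1 => pmul (ppow x n) x

/-- evaluation (a, b) ↦ a + b·z in the field K. -/
def ev (z : K) (x : ℤ × ℤ) : K := (x.1 : K) + (x.2 : K) * z

/-- `ev z` is multiplicative when z² = z − 1. -/
theorem ev_pmul {z : K} (hz : z ^ 2 = z - 1) (x y : ℤ × ℤ) : ev z (pmul x y) = ev z x * ev z y := by
  simp only [ev, pmul]; push_cast; linear_combination (-((x.2 : K) * (y.2 : K))) * hz

/-- `ev z` takes `ppow` to powers when z² = z − 1. -/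
theorem ev_ppow {z : K} (hz : z ^ 2 = z - 1) (x : ℤ × ℤ) (n : ℕ) : ev z (ppow x n) = ev z x ^ n := by
  induction n with
  | zero => simp [ev, ppow]
  | succ n ih => rw [ppow, ev_pmul hz, ih, pow_succ]

/-- `ev z` of an integer constant (c, 0) is c. -/
theorem ev_const (z : K) (c : ℤ) : ev z (c, 0) = (c : K) := by
  simp [ev]

/-- TRANSPORT: an integer-pair identity den·th = g·(dm·dO^S) in ℤ[ζ₆] gives den·ev th = g·ev dm·(ev dO)^S in any field K ∋ z with z² = z − 1. -/
theorem ev_ident {z : K} (hz : z ^ 2 = z - 1) {den g : ℤ} {th dm dO : ℤ × ℤ} {S : ℕ}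
    (h : pmul (den, 0) th = pmul (g, 0) (pmul dm (ppow dO S))) :
    (den : K) * ev z th = (g : K) * ev z dm * ev z dO ^ S := by
  have h' := congrArg (ev z) h
  simp only [ev_pmul hz, ev_ppow hz, ev_const] at h'
  linear_combination h'

end Summit.HodgeConjecture.HodgeConjecture.HodgeLocus.Census.Zeta6Pairs
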